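import Mathlib
import HarnessLib
import Summits.ValiantsHypothesis.ValiantsHypothesis.Theorems.MonotoneRestorationOrbitRestorationQPInjectivePlacementProducts

/-!
# Untwisted `ΠΣ` in SPAN currency: products of line-orbits of local affine forms are narrow (one packaged theorem)

Route MonotoneRestoration, crux `OrbitRestorationQP` (stmt-ValiantsHypothesis-18293), SPAN-currency lane of the open
sub-rung A_∞ (`stub_sigmaPiSigmaValue`); evidence note `SPAN-CURRENCY-A1-g7g4.md` §6.  Helper (`--supports`), def-free.

THE MECHANISM, PACKAGED.  A finite family `(L_i)_{i ∈ ι}` of polynomials is an UNTWISTED ORBIT BLOCK of core size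
`(r, c)` if for some local affine datum `(β₀, δ, α, β, γ)` on `Fin r × Fin c` and some multiplicity `s ≥ 1`,
`s · Σ_i L_i^m = Σ_{φ, ψ injective} (β₀ + δU + ℓ^{φ,ψ})^m` for every `m` — the shape of an untwisted line-orbit of the
factors of a matrix-symmetric affine product (`LocalFactors.exists_rowColSupports_of_matrixSymmetric` for the supports,
`LocalFormShape.eq_localForm_of_rowCol_invariant` for the datum, `s` = placements per line).

* **`prod_orbitBlocks_mem_narrowSpan`** — a scalar multiple of a product of finitely many untwisted orbit blocks, all of
  core size `r_t + c_t + 1 ≤ w`, lies in `span_ℂ {hom_{F,n} : tw F ≤ w}` (orbit form of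
  `…InjectivePlacementProducts.lean` + `NarrowSpanAlgebra.narrowSpan_mul_mem`).

So the untwisted `ΠΣ` theorem of the note is reduced to ONE bookkeeping statement (S2): the factor multiset of an
(untwisted) matrix-symmetric affine product with `≤ n^c + c` factors is a disjoint union of untwisted orbit blocks of core
sizes `≤ (c+1, c+1)`.  Honest label: packaging; no stub closed; VP ≠ VNP untouched.
-/

noncomputable section

-- `Summit.ValiantsHypothesis.ValiantsHypothesis.…` is the tree's single-conjunct layout (Sub = Summit).
set_option linter.dupNamespace false

namespace Summit.ValiantsHypothesis.ValiantsHypothesis.Theorems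

namespace CorePatterns

open MvPolynomial Finset
open Literature.Computability.AlgebraicComplexity (homPoly)
open Literature.Combinatorics.SimpleGraph (treewidth)

/-- **Products of untwisted orbit blocks are narrow.**  Let `T` index finitely many blocks; block `t` is a finite family
`L t : ι t → K[x]` with a local affine datum on the core `Fin (r t) × Fin (c t)` and a multiplicity `s t ≥ 1` such that
`s t · Σ_i (L t i)^m` is the injective-placement power sum of the datum for every `m`, and `r t + c t + 1 ≤ w`.  Then
`C a · Π_t Π_i L t i ∈ span_ℂ {hom_{F,n} : tw F ≤ w}`. [folklore; cite: DwivediPagoSeppelt2026, §8] -/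
theorem prod_orbitBlocks_mem_narrowSpan (n w : ℕ) (a : ℂ) {T : Type} [Fintype T] (ι : T → Type) [∀ t, Fintype (ι t)]
    (L : ∀ t, ι t → MvPolynomial (Fin n × Fin n) ℂ) (r c : T → ℕ) (hw : ∀ t, r t + c t + 1 ≤ w)
    (β₀ δ : T → ℂ) (α : ∀ t, Fin (r t) × Fin (c t) → ℂ) (β : ∀ t, Fin (r t) → ℂ) (γ : ∀ t, Fin (c t) → ℂ)
    (s : T → ℕ) (hs : ∀ t, s t ≠ 0)
    (h : ∀ (t : T) (k : ℕ), s t • (∑ i, L t i ^ k) =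
      ∑ p : {p : (Fin (r t) → Fin n) × (Fin (c t) → Fin n) // Function.Injective p.1 ∧ Function.Injective p.2},
        ((C (β₀ t) + C (δ t) * ∑ i : Fin n, ∑ j : Fin n, (X (i, j) : MvPolynomial (Fin n × Fin n) ℂ)) +
          ((∑ ab : Fin (r t) × Fin (c t), C (α t ab) *
              (X (p.1.1 ab.1, p.1.2 ab.2) : MvPolynomial (Fin n × Fin n) ℂ)) +
            (∑ a' : Fin (r t), C (β t a') * ∑ j : Fin n, (X (p.1.1 a', j) : MvPolynomial (Fin n × Fin n) ℂ)) +
            (∑ b : Fin (c t), C (γ t b) * ∑ j : Fin n, (X (j, p.1.2 b) : MvPolynomial (Fin n × Fin n) ℂ)))) ^ k) :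
    (C a * ∏ t, ∏ i, L t i) ∈ Submodule.span ℂ {p : MvPolynomial (Fin n × Fin n) ℂ |
        ∃ (a b : ℕ) (E : Multiset (Fin a × Fin b)),
          treewidth (SimpleGraph.fromRel fun u v : Fin a ⊕ Fin b =>
            ∃ e ∈ E, u = Sum.inl e.1 ∧ v = Sum.inr e.2) ≤ w ∧ p = homPoly E n ℂ} := by
  classical
  -- each block is narrow with treewidth `≤ r t + c t + 1 ≤ w`
  have hblock : ∀ t, (∏ i, L t i) ∈ Submodule.span ℂ {p : MvPolynomial (Fin n × Fin n) ℂ |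
        ∃ (a b : ℕ) (E : Multiset (Fin a × Fin b)),
          treewidth (SimpleGraph.fromRel fun u v : Fin a ⊕ Fin b =>
            ∃ e ∈ E, u = Sum.inl e.1 ∧ v = Sum.inr e.2) ≤ w ∧ p = homPoly E n ℂ} := by
    intro t
    refine Submodule.span_mono ?_
      (prod_mem_narrowSpan_of_psum_eq_injPlacements n (r t) (c t) (β₀ t) (δ t) (α t) (β t) (γ t) (L t)
        (s t) (hs t) (h t))
    rintro p ⟨a, b, E, hE, rfl⟩
    exact ⟨a, b, E, hE.trans (hw t), rfl⟩
  -- the span is closed under products and contains `1`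
  have hone : (1 : MvPolynomial (Fin n × Fin n) ℂ) ∈ Submodule.span ℂ {p : MvPolynomial (Fin n × Fin n) ℂ |
        ∃ (a b : ℕ) (E : Multiset (Fin a × Fin b)),
          treewidth (SimpleGraph.fromRel fun u v : Fin a ⊕ Fin b =>
            ∃ e ∈ E, u = Sum.inl e.1 ∧ v = Sum.inr e.2) ≤ w ∧ p = homPoly E n ℂ} :=
    Submodule.subset_span ⟨0, 0, 0, by rw [NarrowSpanAlgebra.treewidth_patternGraph_empty]; exact Nat.zero_le _,
      (NarrowSpanAlgebra.homPoly_empty_eq_one n).symm⟩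
  have hprod : (∏ t, ∏ i, L t i) ∈ Submodule.span ℂ {p : MvPolynomial (Fin n × Fin n) ℂ |
        ∃ (a b : ℕ) (E : Multiset (Fin a × Fin b)),
          treewidth (SimpleGraph.fromRel fun u v : Fin a ⊕ Fin b =>
            ∃ e ∈ E, u = Sum.inl e.1 ∧ v = Sum.inr e.2) ≤ w ∧ p = homPoly E n ℂ} := by
    refine Finset.prod_induction _ (fun x => x ∈ Submodule.span ℂ {p : MvPolynomial (Fin n × Fin n) ℂ |
        ∃ (a b : ℕ) (E : Multiset (Fin a × Fin b)),
          treewidth (SimpleGraph.fromRel fun u v : Fin a ⊕ Fin b =>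
            ∃ e ∈ E, u = Sum.inl e.1 ∧ v = Sum.inr e.2) ≤ w ∧ p = homPoly E n ℂ})
      (fun x y hx hy => NarrowSpanAlgebra.narrowSpan_mul_mem n w hx hy) hone fun t _ => hblock t
  rw [← smul_eq_C_mul]
  exact Submodule.smul_mem _ _ hprod

end CorePatterns

end Summit.ValiantsHypothesis.ValiantsHypothesis.Theorems

end
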